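import Summits.HubbardSuperconductivity.HubbardSuperconductivity.Theses.SpNLargeN
import Literature.MathematicalPhysics.QuantumLattice.PairCorrelationsProofs

/-!
# Birth skeleton of piece `TUJWindowFloor` = stmt-HubbardSuperconductivity-19075 (child of `SpnTarget`, stmt-HubbardSuperconductivity-1663; BC3)

Two named stubs and the kernel-checked composition `TUJWindowFloor_of` (Yang's spectral form of
order, at the level of the `t-U-J` window):

* `stub_tUJB1gCondensate` (crux-sized, open-problem): on an open `U`-window and at one doping, every
  unit sector ground state of the `t-U-J` torus model with `J ∈ (0, J₀]` has a `B₁g`-symmetric unit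
  eigenvector `v` of its two-particle reduced density matrix `ρ₂(ψ)` with MACROSCOPIC eigenvalue
  `≥ α L²`, uniformly in `J` and in the even side (pair condensation with `d`-symmetry — existence
  and symmetry of the condensate, no statement about its range);
* `stub_nnOverlapOfB1gCondensate` (crux-sized, research): for `t-U-J` ground states, every such
  macroscopic `B₁g` eigenvector has overlap `|⟨v, φ_d⟩|² ≥ β L²` with the NEAREST-NEIGHBOUR `d`-wave
  pair wavefunction (the condensate has an `O(1)` nearest-neighbour component — false kinematically,
  e.g. for a range-2 `B₁g` geminal, so the ground-state property is load-bearing; uniform in `J`).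

Composition: `⟨Δ_d†Δ_d⟩ = φ_d† ρ₂ φ_d ≥ ev·|⟨v, φ_d⟩|² ≥ (αL²)(βL²)`, i.e. the window floor with
`a = αβ` (`expect_pairField_eq_dotProduct_twoParticleRDM`, `re_dotProduct_mulVec_ge_of_eigenvector`).
-/

set_option linter.dupNamespace false

namespace Summit.HubbardSuperconductivity.HubbardSuperconductivity.Cruxes.SpnTarget.VanishingExchange.BirthTUJWindowFloor

open Matrix Filter Topology Literature.MathematicalPhysics.QuantumLattice

/-- Stub C — `B₁g` pair condensation in `t-U-J` ground states, uniform on the window (crux-sized). -/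
theorem stub_tUJB1gCondensate :
    ∃ U₁ U₂ δ : ℝ, 0 ≤ U₁ ∧ U₁ < U₂ ∧ δ ∈ Set.Ioo (0:ℝ) (1/2) ∧ ∀ U ∈ Set.Ioo U₁ U₂, ∃ J₀ α : ℝ, 0 < J₀ ∧ 0 < α ∧ ∃ k₀ : ℕ, ∀ J ∈ Set.Ioc (0:ℝ) J₀, ∀ k : ℕ, k₀ ≤ k → ∀ ψ : Fock (Orb (FermionTorus 2 (2 * (k + 1)))), star ψ ⬝ᵥ ψ = 1 → IsGroundStateInSector (hubbardTorus 2 (2 * (k + 1)) 1 U - ((J / 4 : ℝ) : ℂ) • ∑ x : FermionTorus 2 (2 * (k + 1)), ∑ y : FermionTorus 2 (2 * (k + 1)), if (fermionTorusGraph 2 (2 * (k + 1))).Adj x y then (annihilation (orb x 0) * annihilation (orb y 1) - annihilation (orb x 1) * annihilation (orb y 0))ᴴ * (annihilation (orb x 0) * annihilation (orb y 1) - annihilation (orb x 1) * annihilation (orb y 0)) else 0) (2 * ⌊(1 - δ) * (((2 * (k + 1)) : ℕ) : ℝ) ^ 2 / 2⌋₊) 0 ψ → ∃ (v : Orb (FermionTorus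 2 (2 * (k + 1))) × Orb (FermionTorus 2 (2 * (k + 1))) → ℂ) (ev : ℝ), star v ⬝ᵥ v = 1 ∧ IsDWaveSymmetric v ∧ twoParticleRDM ψ *ᵥ v = (ev : ℂ) • v ∧ α * ((((2 * (k + 1)) : ℕ) : ℝ)) ^ 2 ≤ ev := by
  sorry

/-- Stub D — nearest-neighbour overlap of macroscopic `B₁g` geminals of `t-U-J` ground states (crux-sized). -/
theorem stub_nnOverlapOfB1gCondensate :
    ∀ U δ J₀ α : ℝ, 0 < U → 0 < J₀ → 0 < α → ∃ β : ℝ, 0 < β ∧ ∃ k₀ : ℕ, ∀ J ∈ Set.Ioc (0:ℝ) J₀, ∀ k : ℕ, k₀ ≤ k → ∀ ψ : Fock (Orb (FermionTorus 2 (2 * (k + 1)))), star ψ ⬝ᵥ ψ = 1 → IsGroundStateInSector (hubbardTorus 2 (2 * (k + 1)) 1 U - ((J / 4 : ℝ) : ℂ) • ∑ x : FermionTorus 2 (2 * (k + 1)), ∑ y : FermionTorus 2 (2 * (k + 1)), if (fermionTorusGraph 2 (2 * (k + 1))).Adj x y then (annihilation (orb x 0) * annihilation (orb y 1) - annihilation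 (orb x 1) * annihilation (orb y 0))ᴴ * (annihilation (orb x 0) * annihilation (orb y 1) - annihilation (orb x 1) * annihilation (orb y 0)) else 0) (2 * ⌊(1 - δ) * (((2 * (k + 1)) : ℕ) : ℝ) ^ 2 / 2⌋₊) 0 ψ → ∀ (v : Orb (FermionTorus 2 (2 * (k + 1))) × Orb (FermionTorus 2 (2 * (k + 1))) → ℂ) (ev : ℝ), star v ⬝ᵥ v = 1 → IsDWaveSymmetric v → twoParticleRDM ψ *ᵥ v = (ev : ℂ) • v → α * ((((2 * (k + 1)) : ℕ) : ℝ)) ^ 2 ≤ ev → β * ((((2 * (k + 1)) : ℕ) : ℝ)) ^ 2 ≤ ‖star v ⬝ᵥ pairFieldWavefunction dWaveFormFactor (2 * (k + 1))‖ ^ 2 := by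
  sorry

/-- Composition: (C) → (D) → `TUJWindowFloor` (the child statement verbatim), by Yang's algebra
`Re⟨ψ, Δ_d†Δ_d ψ⟩ = Re(φ_d† ρ₂(ψ) φ_d) ≥ ev · |⟨v, φ_d⟩|² ≥ α β L⁴`. -/
theorem tUJWindowFloor_of_pieces :
    (∃ U₁ U₂ δ : ℝ, 0 ≤ U₁ ∧ U₁ < U₂ ∧ δ ∈ Set.Ioo (0:ℝ) (1/2) ∧ ∀ U ∈ Set.Ioo U₁ U₂, ∃ J₀ α : ℝ, 0 < J₀ ∧ 0 < α ∧ ∃ k₀ : ℕ, ∀ J ∈ Set.Ioc (0:ℝ) J₀, ∀ k : ℕ, k₀ ≤ k → ∀ ψ : Fock (Orb (FermionTorus 2 (2 * (k + 1)))), star ψ ⬝ᵥ ψ = 1 → IsGroundStateInSector (hubbardTorus 2 (2 * (k + 1)) 1 U - ((J / 4 : ℝ) : ℂ) • ∑ x : FermionTorus 2 (2 * (k + 1)), ∑ y : FermionTorus 2 (2 * (k + 1)), if (fermionTorusGraph 2 (2 * (k + 1))).Adj x y then (annihilation (orb x 0) * annihilation (orb y 1) - annihilation (orb x 1) * annihilation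 (orb y 0))ᴴ * (annihilation (orb x 0) * annihilation (orb y 1) - annihilation (orb x 1) * annihilation (orb y 0)) else 0) (2 * ⌊(1 - δ) * (((2 * (k + 1)) : ℕ) : ℝ) ^ 2 / 2⌋₊) 0 ψ → ∃ (v : Orb (FermionTorus 2 (2 * (k + 1))) × Orb (FermionTorus 2 (2 * (k + 1))) → ℂ) (ev : ℝ), star v ⬝ᵥ v = 1 ∧ IsDWaveSymmetric v ∧ twoParticleRDM ψ *ᵥ v = (ev : ℂ) • v ∧ α * ((((2 * (k + 1)) : ℕ) : ℝ)) ^ 2 ≤ ev) →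
    (∀ U δ J₀ α : ℝ, 0 < U → 0 < J₀ → 0 < α → ∃ β : ℝ, 0 < β ∧ ∃ k₀ : ℕ, ∀ J ∈ Set.Ioc (0:ℝ) J₀, ∀ k : ℕ, k₀ ≤ k → ∀ ψ : Fock (Orb (FermionTorus 2 (2 * (k + 1)))), star ψ ⬝ᵥ ψ = 1 → IsGroundStateInSector (hubbardTorus 2 (2 * (k + 1)) 1 U - ((J / 4 : ℝ) : ℂ) • ∑ x : FermionTorus 2 (2 * (k + 1)), ∑ y : FermionTorus 2 (2 * (k + 1)), if (fermionTorusGraph 2 (2 * (k + 1))).Adj x y then (annihilation (orb x 0) * annihilation (orb y 1) - annihilation (orb x 1) * annihilation (orb y 0))ᴴ * (annihilation (orb x 0) * annihilation (orb y 1) - annihilation (orb x 1) * annihilation (orb y 0)) else 0) (2 * ⌊(1 - δ) * (((2 * (k + 1)) : ℕ) : ℝ) ^ 2 / 2⌋₊) 0 ψ → ∀ (v : Orb (FermionTorus 2 (2 * (k + 1))) × Orb (FermionTorus 2 (2 * (k + 1))) → ℂ) (ev : ℝ), star v ⬝ᵥ v = 1 → IsDWaveSymmetric v → twoParticleRDM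 ψ *ᵥ v = (ev : ℂ) • v → α * ((((2 * (k + 1)) : ℕ) : ℝ)) ^ 2 ≤ ev → β * ((((2 * (k + 1)) : ℕ) : ℝ)) ^ 2 ≤ ‖star v ⬝ᵥ pairFieldWavefunction dWaveFormFactor (2 * (k + 1))‖ ^ 2) →
    (∃ U₁ U₂ δ : ℝ, 0 ≤ U₁ ∧ U₁ < U₂ ∧ δ ∈ Set.Ioo (0:ℝ) (1/2) ∧ ∀ U ∈ Set.Ioo U₁ U₂, ∃ J₀ a : ℝ, 0 < J₀ ∧ 0 < a ∧ ∃ k₀ : ℕ, ∀ J ∈ Set.Ioc (0:ℝ) J₀, ∀ k : ℕ, k₀ ≤ k → ∀ ψ : Fock (Orb (FermionTorus 2 (2 * (k + 1)))), star ψ ⬝ᵥ ψ = 1 → IsGroundStateInSector (hubbardTorus 2 (2 * (k + 1)) 1 U - ((J / 4 : ℝ) : ℂ) • ∑ x : FermionTorus 2 (2 * (k + 1)), ∑ y : FermionTorus 2 (2 * (k + 1)), if (fermionTorusGraph 2 (2 * (k + 1))).Adj x y then (annihilation (orb x 0) * annihilation (orb y 1) - annihilation (orb x 1) * annihilation (orb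 y 0))ᴴ * (annihilation (orb x 0) * annihilation (orb y 1) - annihilation (orb x 1) * annihilation (orb y 0)) else 0) (2 * ⌊(1 - δ) * ((2 * (k + 1) : ℕ) : ℝ) ^ 2 / 2⌋₊) 0 ψ → a ≤ (expect ((pairField dWaveFormFactor (2 * (k + 1)))ᴴ * pairField dWaveFormFactor (2 * (k + 1))) ψ).re / (((2 * (k + 1) : ℕ) : ℝ) ^ 4)) := by
  intro hC hD
  obtain ⟨U₁, U₂, δ, hU₁, hU₁₂, hδ, hwin⟩ := hC
  refine ⟨U₁, U₂, δ, hU₁, hU₁₂, hδ, fun U hU => ?_⟩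
  obtain ⟨J₀, α, hJ₀, hα, k₁, hcond⟩ := hwin U hU
  have hUpos : 0 < U := lt_of_le_of_lt hU₁ hU.1
  obtain ⟨β, hβ, k₂, hov⟩ := hD U δ J₀ α hUpos hJ₀ hα
  refine ⟨J₀, α * β, hJ₀, mul_pos hα hβ, max k₁ k₂, fun J hJ k hk ψ hψ hGS => ?_⟩
  obtain ⟨v, ev, hv1, hsym, hev, hevge⟩ := hcond J hJ k (le_of_max_le_left hk) ψ hψ hGS
  have hovl := hov J hJ k (le_of_max_le_right hk) ψ hψ hGS v ev hv1 hsym hev hevge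
  have hLpos : (0 : ℝ) < (((2 * (k + 1) : ℕ) : ℝ)) ^ 4 := by positivity
  rw [le_div_iff₀ hLpos]
  rw [expect_pairField_eq_dotProduct_twoParticleRDM dWaveFormFactor (2 * (k + 1))
    expect_pairAnnihilator_conjTranspose_mul_holds (pairField_eq_pairAnnihilator_dWave (2 * (k + 1)))]
  have hkey := re_dotProduct_mulVec_ge_of_eigenvector
    (fun u : Orb (FermionTorus 2 (2 * (k + 1))) × Orb (FermionTorus 2 (2 * (k + 1))) → ℂ =>
      pairAnnihilator u *ᵥ ψ)
    (fun x y => by simp only [pairAnnihilator_add, add_mulVec])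
    (fun a x => by simp only [pairAnnihilator_smul, smul_mulVec])
    (twoParticleRDM ψ) (star_dotProduct_twoParticleRDM_mulVec ψ) v
    (pairFieldWavefunction dWaveFormFactor (2 * (k + 1))) ev hv1 hev
  have hαL : (0 : ℝ) ≤ α * (((2 * (k + 1) : ℕ) : ℝ)) ^ 2 := by positivity
  have hev0 : (0 : ℝ) ≤ ev := le_trans hαL hevge
  calc α * β * (((2 * (k + 1) : ℕ) : ℝ)) ^ 4
      = (α * (((2 * (k + 1) : ℕ) : ℝ)) ^ 2) * (β * (((2 * (k + 1) : ℕ) : ℝ)) ^ 2) := by ring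
    _ ≤ ev * ‖star v ⬝ᵥ pairFieldWavefunction dWaveFormFactor (2 * (k + 1))‖ ^ 2 :=
        mul_le_mul hevge hovl (by positivity) hev0
    _ ≤ _ := hkey

/-- The piece BY NAME from its stubs: the route decl `TUJWindowFloor`
(stmt-HubbardSuperconductivity-19075) unfolds to the conclusion of `tUJWindowFloor_of_pieces`. -/
theorem TUJWindowFloor_of :
    Summit.HubbardSuperconductivity.HubbardSuperconductivity.Theses.SpNLargeN.TUJWindowFloor :=
  tUJWindowFloor_of_pieces stub_tUJB1gCondensate stub_nnOverlapOfB1gCondensate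

end Summit.HubbardSuperconductivity.HubbardSuperconductivity.Cruxes.SpnTarget.VanishingExchange.BirthTUJWindowFloor
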